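import Literature.NumberTheory.EllipticCurves.LocalRestrictionDegree
import Literature.NumberTheory.EllipticCurves.SelmerTorsionRestriction
import Literature.NumberTheory.EllipticCurves.ArchimedeanLocalConditionTorsion
import Literature.NumberTheory.EllipticCurves.Rank1Residual.Typed.X5DescentSelmer
import HarnessLib

/-!
# Selmer classes along a quadratic extension, finite level: `res ξ` Selmer over `L` ⟹ `[2]_* ξ` Selmer over `K`

Finite-level (torsion-coefficient) companion of
`Literature.NumberTheory.EllipticCurves.LocalRestrictionDegree`, whose headline results are stated
for `H¹(K, E)` (`two_nsmul_mem_sha_of_resBaseChange_mem_sha`) and for `H¹(K, E[p^∞])`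
(`two_nsmul_mem_selmerGroupPInfty_of_res_mem`). For a Weierstrass curve `W` (an elliptic curve
`E`) over a number field `K`, a finite extension `L/K` of degree `≤ 2`, levels `n ∣ 2d` and a class
`ξ ∈ H¹(K, E[n])`:

* `torsionH1ZSMul_two_mem_selmerLocalKer_of_resTorsion_mem` — if the restriction
  `res ξ ∈ H¹(L, E_L[n])` (`resTorsion`) satisfies the Selmer local condition at a finite place `w`
  of `L` above `v`, then `[2]_* ξ ∈ H¹(K, E[d])` (`WeierstrassCurve.torsionH1ZSMul W 2`, the map
  induced by `2 · : E[n] → E[d]`) satisfies the Selmer local condition at `v`;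
  `…_infinitePlace` — the same at an infinite place;
* `torsionH1ZSMul_two_mem_selmerGroup_of_resTorsion_mem` — **if `res ξ ∈ Sel^{(n)}(E_L/L)` then
  `[2]_* ξ ∈ Sel^{(d)}(E/K)`** (the same-level form `2 ξ ∈ Sel^{(n)}(E/K)` is the tree's
  `two_nsmul_mem_selmerGroup_of_resTorsion_mem` of `SelmerTorsionRestrictionExact`);
  `mem_selmerGroup_of_torsionH1ToH1_eq_two_nsmul` is the version for any class `ξ₀` with
  `(E[d] ↪ E)_* ξ₀ = 2 · (E[n] ↪ E)_* ξ`.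

Mechanism (all in the tree): the Selmer local condition of a class of `H¹(K, E[m])` at a `K`-field
is the vanishing of its image in `H¹(·, E)` (`mem_selmerLocalKer_iff_torsionH1ToH1_mem`); images
in `H¹(K, E)` commute with restriction (`torsionH1ToH1_resTorsion`,
`mem_localRestrictionKer_iff_resBaseChange_mem`) and with `[2]_*`
(`torsionH1ToH1_torsionH1ZSMul`: `(E[d] ↪ E)_* ∘ [2]_* = 2 · (E[n] ↪ E)_*`); and a class of
`H¹(K, E)` dying over `L_w` with `[L_w : K_v] ≤ [L : K] ≤ 2` is killed by `2` over `K_v`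
(`two_nsmul_mem_localRestrictionKer_of_tower`, `finrank_adicCompletion_le_of_liesOver`,
`finrank_completion_le_two`). This is the local half of Dokchitser–Dokchitser's "cokernel of
`Sel(E/K) → Sel(E/F)^G` killed by `|G|²`" (Ann. of Math. 172 (2010), proof of Lemma 4.14) at finite
level.

Use (Kolyvagin's derivative classes at `p = 2`, McCallum 1991 §4): over an imaginary quadratic `K`,
`c_M(n) = [2]_* c_{M+1}(n)` for `n ∈ S(M+1)` (Lemma 4.6 / the definition of `c_M(n)` from
`P_n mod 2^{M+1}`), and `c_{M+1}(n)` is Selmer at every place of `K` prime to `n` (Lemma 4.3); so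
the unique class of `H¹(ℚ, E^{(±)}[2^M])` restricting to `c_M(n)` is Selmer over `ℚ` at every place
prime to `n` — INCLUDING the primes ramified in `K`, where a descended class of level exactly `M`
may carry a non-trivial genus component `H¹(K_𝔮/ℚ_q, E(K_𝔮)) ≅ ℤ/2`. Everything here is proved;
no named fact is introduced.

## References

* T. Dokchitser, V. Dokchitser, Ann. of Math. 172 (2010), Lemma 4.14 (proof).
  [DokchitserDokchitserAnnals2010]
* J.-P. Serre, *Galois Cohomology* (1997), I.§2.4 (Cor. to Prop. 9), II.§1.1.
  [SerreGaloisCohomology1997]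
* W. G. McCallum, *Kolyvagin's work on Shafarevich–Tate groups*, LMS LN 153 (1991), §4
  (Lemma 4.3, Lemma 4.6). [McCallumLMS1991]
-/

noncomputable section

open scoped Classical

universe u

open Literature.NumberTheory.GaloisRepresentations WeierstrassCurve NumberField
open IsDedekindDomain (HeightOneSpectrum)

namespace Literature.NumberTheory.EllipticCurves

/-! ## `[2]_*` and the map to `H¹(K, E)` -/

section Level

variable {K : Type u} [Field K] (W : WeierstrassCurve K) {d n : ℤ}

/-- `(E[d] ↪ E)_* ([2]_* ξ) = 2 · (E[n] ↪ E)_* ξ` with the natural-number scalar `2` (the tree's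
`torsionH1ToH1_torsionH1ZSMul` with `m = 2`). [cite: SilvermanAEC2009, X.§4 (proof of X.4.2, functoriality of the Kummer diagram)] -/
theorem torsionH1ToH1_torsionH1ZSMul_two (hm : n ∣ d * 2) (ξ : galH1Torsion W n) :
    torsionH1ToH1 W d (torsionH1ZSMul W 2 hm ξ) = 2 • torsionH1ToH1 W n ξ := by
  rw [torsionH1ToH1_torsionH1ZSMul, ← natCast_zsmul]
  rfl

end Level

/-! ## Local conditions along `K_v → L_w`, `[L : K] ≤ 2` -/

section NumberField

variable {K : Type u} [Field K] [NumberField K] (W : WeierstrassCurve K)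
variable (L : Type u) [Field L] [NumberField L] [Algebra K L]

/-- **Finite places.** Let `[L : K] ≤ 2`, `n ∣ 2d`, `w` a finite place of `L` above the finite place
`v` of `K`, and `ξ ∈ H¹(K, E[n])`. If `res ξ ∈ H¹(L, E_L[n])` satisfies the Selmer local condition at
`L_w`, then `[2]_* ξ ∈ H¹(K, E[d])` satisfies it at `K_v`: the image of `ξ` in `H¹(K, E)` dies over
`L_w` (`torsionH1ToH1_resTorsion`, `mem_localRestrictionKer_iff_resBaseChange_mem`), hence twice it
dies over `K_v` (`two_nsmul_mem_localRestrictionKer_of_tower`, `[L_w : K_v] ≤ [L : K] ≤ 2`), and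
twice it is the image of `[2]_* ξ`. [cite: DokchitserDokchitserAnnals2010, Lemma 4.14 (proof)]
[cite: SerreGaloisCohomology1997, I.§2.4 Cor. to Prop. 9] -/
theorem torsionH1ZSMul_two_mem_selmerLocalKer_of_resTorsion_mem (h2 : Module.finrank K L ≤ 2)
    {d n : ℤ} (hm : n ∣ d * 2) (v : HeightOneSpectrum (𝓞 K)) (w : HeightOneSpectrum (𝓞 L))
    [w.asIdeal.LiesOver v.asIdeal] {ξ : galH1Torsion W n}
    (hξ : resTorsion W L n ξ ∈ selmerLocalKer (W.baseChange L) (w.adicCompletion L) n) :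
    torsionH1ZSMul W 2 hm ξ ∈ selmerLocalKer W (v.adicCompletion K) d := by
  obtain ⟨hfin, hle⟩ := finrank_adicCompletion_le_of_liesOver L v w
  letI : Algebra (v.adicCompletion K) (w.adicCompletion L) :=
    (adicCompletionMap (K := K) L v w).toAlgebra
  haveI : IsScalarTower K (v.adicCompletion K) (w.adicCompletion L) :=
    IsScalarTower.of_algebraMap_eq fun x ↦ (adicCompletionMap_coe (K := K) L v w x).symm
  haveI : FiniteDimensional (v.adicCompletion K) (w.adicCompletion L) := hfin
  haveI : CharZero (v.adicCompletion K) :=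
    charZero_of_injective_algebraMap (algebraMap K (v.adicCompletion K)).injective
  rw [mem_selmerLocalKer_iff_torsionH1ToH1_mem, torsionH1ToH1_resTorsion] at hξ
  have hx : torsionH1ToH1 W n ξ ∈ W.localRestrictionKer (w.adicCompletion L) :=
    (mem_localRestrictionKer_iff_resBaseChange_mem W _).mpr hξ
  rw [mem_selmerLocalKer_iff_torsionH1ToH1_mem, torsionH1ToH1_torsionH1ZSMul_two]
  exact two_nsmul_mem_localRestrictionKer_of_tower W (E := v.adicCompletion K) (hle.trans h2) hx

omit [NumberField L] in
/-- **Infinite places.** The same at an infinite place `w` of `L` above `v` (here `[L_w : K_v] ≤ 2`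
for any `L/K`). [cite: DokchitserDokchitserAnnals2010, Lemma 4.14 (proof)]
[cite: SerreGaloisCohomology1997, I.§2.4 Cor. to Prop. 9] -/
theorem torsionH1ZSMul_two_mem_selmerLocalKer_infinitePlace_of_resTorsion_mem
    {d n : ℤ} (hm : n ∣ d * 2) (w : InfinitePlace L) {ξ : galH1Torsion W n}
    (hξ : resTorsion W L n ξ ∈ selmerLocalKer (W.baseChange L) w.Completion n) :
    torsionH1ZSMul W 2 hm ξ ∈ selmerLocalKer W (w.comap (algebraMap K L)).Completion d := by
  set v : InfinitePlace K := w.comap (algebraMap K L)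
  haveI : w.1.LiesOver v.1 := ⟨rfl⟩
  obtain ⟨hfin, hle⟩ := finrank_completion_le_two (K := K) L v w
  haveI : IsScalarTower K L w.Completion := IsScalarTower.of_algebraMap_eq fun x ↦ by
    apply NumberField.InfinitePlace.Completion.ext
    rw [NumberField.InfinitePlace.Completion.algebraMap_toCompletion,
      NumberField.InfinitePlace.Completion.algebraMap_toCompletion,
      UniformSpace.Completion.algebraMap_def, UniformSpace.Completion.algebraMap_def,
      IsScalarTower.algebraMap_apply K L (WithAbs w.1)]
  letI : Algebra v.Completion w.Completion := NumberField.LiesOver.instAlgebraCompletion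
  haveI : IsScalarTower K v.Completion w.Completion :=
    NumberField.LiesOver.instIsScalarTowerCompletion
  haveI : FiniteDimensional v.Completion w.Completion := hfin
  haveI : CharZero v.Completion :=
    charZero_of_injective_algebraMap (algebraMap K v.Completion).injective
  rw [mem_selmerLocalKer_iff_torsionH1ToH1_mem, torsionH1ToH1_resTorsion] at hξ
  have hx : torsionH1ToH1 W n ξ ∈ W.localRestrictionKer w.Completion :=
    (mem_localRestrictionKer_iff_resBaseChange_mem W _).mpr hξ
  rw [mem_selmerLocalKer_iff_torsionH1ToH1_mem, torsionH1ToH1_torsionH1ZSMul_two]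
  exact two_nsmul_mem_localRestrictionKer_of_tower W (E := v.Completion) hle hx

/-! ## Selmer groups -/

/-- **If `res ξ ∈ Sel^{(n)}(E_L/L)` for `[L : K] ≤ 2` then `[2]_* ξ ∈ Sel^{(d)}(E/K)` (`n ∣ 2d`).**
The Selmer groups are the preimages of `Ш` under `H¹(·, E[m]) → H¹(·, E)`
(`selmerGroup_eq_comap_sha`); the image of `ξ` restricts into `Ш(E_L/L)`, so twice it lies in
`Ш(E/K)` (`two_nsmul_mem_sha_of_resBaseChange_mem_sha`), and twice it is the image of `[2]_* ξ`.
[cite: DokchitserDokchitserAnnals2010, Lemma 4.14 (proof)] -/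
theorem torsionH1ZSMul_two_mem_selmerGroup_of_resTorsion_mem (h2 : Module.finrank K L ≤ 2)
    {d n : ℤ} (hm : n ∣ d * 2) {ξ : galH1Torsion W n}
    (hξ : resTorsion W L n ξ ∈ selmerGroup (W.baseChange L) n) :
    torsionH1ZSMul W 2 hm ξ ∈ selmerGroup W d := by
  rw [selmerGroup_eq_comap_sha, AddSubgroup.mem_comap] at hξ ⊢
  rw [torsionH1ToH1_resTorsion] at hξ
  rw [torsionH1ToH1_torsionH1ZSMul_two]
  exact two_nsmul_mem_sha_of_resBaseChange_mem_sha W L h2 hξ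

/-- Version for an arbitrary lift: if `ξ ∈ H¹(K, E[n])` restricts into `Sel^{(n)}(E_L/L)`
(`[L : K] ≤ 2`) and `ξ₀ ∈ H¹(K, E[d])` has image `(E[d] ↪ E)_* ξ₀ = 2 · (E[n] ↪ E)_* ξ` in
`H¹(K, E)` (e.g. `ξ₀ = [2]_* ξ`, or `ξ₀` the image of `[2]_* ξ` under an inclusion of levels), then
`ξ₀ ∈ Sel^{(d)}(E/K)`. [cite: DokchitserDokchitserAnnals2010, Lemma 4.14 (proof)] -/
theorem mem_selmerGroup_of_torsionH1ToH1_eq_two_nsmul (h2 : Module.finrank K L ≤ 2) {d n : ℤ}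
    {ξ : galH1Torsion W n} {ξ₀ : galH1Torsion W d}
    (hξ₀ : torsionH1ToH1 W d ξ₀ = 2 • torsionH1ToH1 W n ξ)
    (hξ : resTorsion W L n ξ ∈ selmerGroup (W.baseChange L) n) :
    ξ₀ ∈ selmerGroup W d := by
  rw [selmerGroup_eq_comap_sha, AddSubgroup.mem_comap] at hξ ⊢
  rw [torsionH1ToH1_resTorsion] at hξ
  rw [hξ₀]
  exact two_nsmul_mem_sha_of_resBaseChange_mem_sha W L h2 hξ

end NumberField

/-! ## Appendix (same seat, append): naturality of `[m]_*` and the "all places above `v`" forms -/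

section Naturality

variable {K : Type u} [Field K] (W : WeierstrassCurve K) (L : Type u) [Field L] [Algebra K L]
  {d n : ℤ}

/-- **`[m]_*` commutes with restriction**: `res ∘ [m]_* = [m]_* ∘ res :
H¹(K, E[n]) → H¹(L, E_L[d])` (both are the map of the compatible pair
`(resGal L, P ↦ m·P ↦ E_L(L̄))`). So the restriction of `[2]_* ξ` is `[2]_* (res ξ)`: if `res ξ`
is a given class `y` over `L` (a descended Kolyvagin class: `res ξ = c_{M+1}(n)`), then `[2]_* ξ`
descends `[2]_* y` (`= c_M(n)`, McCallum 1991 Lemma 4.6).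
[cite: SerreGaloisCohomology1997, I.§2.4 (compatible pairs)] [cite: McCallumLMS1991, §4 Lemma 4.6] -/
theorem resTorsion_torsionH1ZSMul (m : ℤ) (hm : n ∣ d * m) (x : galH1Torsion W n) :
    resTorsion W L d (torsionH1ZSMul W m hm x) =
      torsionH1ZSMul (W.baseChange L) m hm (resTorsion W L n x) := by
  change resH1Hom (resGal (K := K) L) (torsionBaseChangeMap W L d) (torsionBaseChangeMap_smul W L d)
      (resH1Hom (ContinuousMonoidHom.id _) (geomTorsionZSMul W m hm)
        (fun σ P ↦ geomTorsionZSMul_smul W m hm σ P) x) =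
    resH1Hom (ContinuousMonoidHom.id _) (geomTorsionZSMul (W.baseChange L) m hm)
      (fun σ P ↦ geomTorsionZSMul_smul (W.baseChange L) m hm σ P)
      (resH1Hom (resGal (K := K) L) (torsionBaseChangeMap W L n) (torsionBaseChangeMap_smul W L n) x)
  rw [resH1Hom_resH1Hom, resH1Hom_resH1Hom]
  refine congrFun (congrArg DFunLike.coe (resH1Hom_congr (by ext; rfl) ?_ _ _)) x
  ext P
  change ((localPointsEquivGeomPoints W L (pointsMap W L ((m • (P : geomPoints W)) : geomPoints W)) :
      geomPoints (W.baseChange L)) : _) =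
    m • (localPointsEquivGeomPoints W L (pointsMap W L (P : geomPoints W)) : geomPoints (W.baseChange L))
  rw [map_zsmul, map_zsmul]

end Naturality

section AllPlaces

variable {K : Type u} [Field K] [NumberField K] (W : WeierstrassCurve K)
variable (L : Type u) [Field L] [NumberField L] [Algebra K L]

/-- **Finite places, "Selmer at every place of `L` above `v`" form** (the shape in which a
Kolyvagin class is known to be Selmer over `L = K(√D)` at the places prime to `n`): if `res ξ`
satisfies the Selmer local condition at every finite place `w` of `L` above the finite place `v` of
`K` (`[L : K] ≤ 2`, `n ∣ 2d`), then `[2]_* ξ` satisfies it at `v` (some `w ∣ v` exists,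
`exists_liesOver`). [cite: DokchitserDokchitserAnnals2010, Lemma 4.14 (proof)] -/
theorem torsionH1ZSMul_two_mem_selmerLocalKer_of_forall_liesOver (h2 : Module.finrank K L ≤ 2)
    {d n : ℤ} (hm : n ∣ d * 2) (v : HeightOneSpectrum (𝓞 K)) {ξ : galH1Torsion W n}
    (hξ : ∀ w : HeightOneSpectrum (𝓞 L), w.asIdeal.LiesOver v.asIdeal →
      resTorsion W L n ξ ∈ selmerLocalKer (W.baseChange L) (w.adicCompletion L) n) :
    torsionH1ZSMul W 2 hm ξ ∈ selmerLocalKer W (v.adicCompletion K) d := by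
  obtain ⟨w, hw⟩ := exists_liesOver L v
  haveI := hw
  exact torsionH1ZSMul_two_mem_selmerLocalKer_of_resTorsion_mem W L h2 hm v w (hξ w hw)

omit [NumberField L] in
/-- **Infinite places, "every place of `L` above `v`" form**: if `res ξ` satisfies the Selmer local
condition at every infinite place `w` of `L` above the infinite place `v` of `K`, then `[2]_* ξ`
satisfies it at `v` (`InfinitePlace.comap_surjective`). [cite: DokchitserDokchitserAnnals2010, Lemma 4.14 (proof)] -/
theorem torsionH1ZSMul_two_mem_selmerLocalKer_infinitePlace_of_forall_comap
    [Algebra.IsAlgebraic K L] {d n : ℤ} (hm : n ∣ d * 2) (v : InfinitePlace K) {ξ : galH1Torsion W n}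
    (hξ : ∀ w : InfinitePlace L, w.comap (algebraMap K L) = v →
      resTorsion W L n ξ ∈ selmerLocalKer (W.baseChange L) w.Completion n) :
    torsionH1ZSMul W 2 hm ξ ∈ selmerLocalKer W v.Completion d := by
  obtain ⟨w, hw⟩ := InfinitePlace.comap_surjective (k := K) (K := L) v
  subst hw
  exact torsionH1ZSMul_two_mem_selmerLocalKer_infinitePlace_of_resTorsion_mem W L hm w (hξ w rfl)

end AllPlaces

end Literature.NumberTheory.EllipticCurves

end
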